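import Literature.Analysis.FluidPDE.TypeIAncientMild
import Literature.Analysis.FluidPDE.NSLerayHopfSereginEnergyProofs
import Literature.Analysis.FluidPDE.TaoQuantitativeOseenRepresentation
import Literature.Analysis.FluidPDE.OseenMildUniqueness
import Literature.Analysis.FluidPDE.RusinSverakSingularPointProofs
import Literature.Analysis.FluidPDE.LerayLocalRegularH1Proofs
import Literature.Analysis.FluidPDE.KatoMaximalTimeSingular
import HarnessLib

/-!
# Route `FilamentSkeletonRss`, crux `RdssProfileTruncation` (stmt-NavierStokesRegularity-11289),
  line `Sketch` — stub `stub_oseenClassicalPackage` (Oseen gauge ⇒ classical + Leray–Hopf)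

A field `v` on `[0, T) × ℝ³` which is jointly continuous, bounded on every `[0, T − δ]`, weakly
divergence free slice by slice, and solves the Oseen integral equation
`v(t) = e^{(t−s)Δ}v(s) − B¹ₛ(v,v)(t)` between all pairs `0 ≤ s < t < T`, from a smooth compactly
supported divergence-free datum `v 0`, is the velocity of a classical solution on `[0, T)` which is
Leray–Hopf on every `[0, T']`, `T' < T`.  The proof is the **Kato route**, an assembly of proved
tree theorems:

* the datum `v 0 ∈ C_c^∞` is rapidly decaying (`HasRapidSpatialDecay.of_hasCompactSupport`), in
  `L³`, weakly divergence free, so `T_max := katoMaximalTime 1 (v 0) > 0`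
  (`katoMaximalTime_pos`, `kato_local_holds`);
* along any Kato solution from `v 0`, Tao-class classical solutions exist on every closed
  sub-slab (`exists_isTaoSolutionOn_of_isKatoSolutionOn`, von Wahl / Lemarié-Rieusset Prop. 12.3);
* **identification** (`tao_velocity_eq_of_oseenMild`): a Tao-class solution `(u, p)` on `[0, S]`,
  `S < T`, satisfies `u(t) = e^{tΔ}v(0) − B¹₀(u,u)(t)` a.e.
  (`IsTaoSolutionOn.ae_eq_heatExtension_sub_oseenDuhamel`), and so does `v` (hypothesis with
  `s = 0`); both are bounded and measurable on `(0, S) × ℝ³`, hence agree a.e. at every time by the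
  uniqueness of bounded solutions of the Oseen integral equation (`oseenMild_bounded_unique`,
  KNSS 2009 §4), and everywhere by continuity;
* **no early stop** (`exists_isTaoSolutionOn_of_oseenMild`): if `T_max < T`, the maximal Kato
  solution (`exists_isKatoSolutionOn_katoMaximalTime`, `kato_unique_holds`) agrees a.e. with `v`
  on `(0, T_max) × ℝ³` (slice-wise through the Tao-class solutions, `IsTaoSolutionOn.ae_eq_of_kato`,
  then Fubini `ae_restrict_prod_of_forall_ae_eq`), hence is essentially bounded there, and the
  `L^∞` continuation of Kato solutions (`IsKatoSolutionOn.continuation_of_bounded_holds`)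
  contradicts maximality; so Tao-class solutions from `v 0` exist on every `[0, S]`, `S < T`;
* **packaging**: all these Tao-class velocities coincide with `v`, their pressures then coincide
  (`IsTaoSolutionOn.pressure_eq`), so `v` with the glued pressure is classical on `Ico 0 T`
  (smoothness and the momentum equation are local in time; the one-sided derivative within
  `Ico 0 T` at `t < S` is the derivative within `Icc 0 S`), and `v` is Leray–Hopf on `[0, T']`
  (`IsTaoSolutionOn.isLerayHopfOn`, transferred by `IsLerayHopfOn.congr_ae_slices`).
-/

noncomputable section

open MeasureTheory Set Filter Topology Function
open scoped ContDiff ENNReal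
open Literature.Analysis Literature.Analysis.FluidPDE

set_option linter.dupNamespace false

namespace Summit.NavierStokesRegularity.NavierStokesRegularity.Theorems

/-- Physical space `ℝ³`. -/
local notation "ℝ³" => EuclideanSpace ℝ (Fin 3)

/-- A field jointly continuous on `[0, T) × ℝ³` is (a.e. strongly) measurable on every strip
`(0, S) × ℝ³`, `S ≤ T`. [folklore] -/
theorem aestronglyMeasurable_strip_of_continuousOn_Ico {T S : ℝ} {v : ℝ → ℝ³ → ℝ³}
    (hcont : ContinuousOn (uncurry v) (Ico 0 T ×ˢ univ)) (hST : S ≤ T) :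
    AEStronglyMeasurable (uncurry v) (volume.restrict (Ioo 0 S ×ˢ univ)) :=
  (hcont.mono (prod_mono (fun _ ht => ⟨ht.1.le, ht.2.trans_le hST⟩)
    Subset.rfl)).aestronglyMeasurable (measurableSet_Ioo.prod MeasurableSet.univ)

/-- **Identification of a Tao-class solution with the Oseen-mild field.** Let `v` be jointly
continuous on `[0, T) × ℝ³`, bounded on every `[0, T − δ]`, and solve the Oseen integral equation
between all pairs `0 ≤ s < t < T`; let `(u, p)` be a Tao-class solution on `[0, S]`, `0 < S < T`,
from the datum `v 0`.  Then `u = v` on `[0, S]`: both satisfy `w(t) = e^{tΔ}v(0) − B¹₀(w,w)(t)`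
a.e. for `t ∈ (0, S)` (`IsTaoSolutionOn.ae_eq_heatExtension_sub_oseenDuhamel` for `u`, the
hypothesis with `s = 0` for `v`), both are bounded and measurable on `(0, S) × ℝ³`, so they agree
a.e. at every time by uniqueness of bounded solutions of the integral equation
(`oseenMild_bounded_unique`), and everywhere since the slices are continuous and the time lines
are continuous on `[0, S] = closure (0, S)`.
[cite: KochNadirashviliSereginSverak2009, §4 (4.3)–(4.4) (arXiv:0709.3599 p. 8)] -/
theorem tao_velocity_eq_of_oseenMild {T S : ℝ} {v u : ℝ → ℝ³ → ℝ³} {p : ℝ → ℝ³ → ℝ}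
    (hcont : ContinuousOn (uncurry v) (Ico 0 T ×ˢ univ))
    (hoseen : ∀ s t : ℝ, 0 ≤ s → s < t → t < T → ∀ x,
      v t x = heatFlow (v s) (t - s) x - oseenDuhamel 1 s v v t x)
    (hbdd : ∀ δ : ℝ, 0 < δ → IsBoundedOn (Icc 0 (T - δ)) v)
    (hS : 0 < S) (hST : S < T) (h : IsTaoSolutionOn S 1 (v 0) u p) :
    ∀ t ∈ Icc 0 S, u t = v t := by
  -- bounds on `(0, S) × ℝ³`
  obtain ⟨B, hB0, hB⟩ := h.exists_bound_velocity
  obtain ⟨M, hM⟩ := hbdd (T - S) (sub_pos.2 hST)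
  rw [sub_sub_cancel] at hM
  have hL0 : 0 ≤ max B M := hB0.trans (le_max_left _ _)
  -- the two integral equations from `s = 0`
  have hu : ∀ t ∈ Ioo 0 S, u t =ᵐ[volume] fun x =>
      UnboundedOperators.heatExtension (v 0) t x - oseenDuhamel 1 0 u u t x :=
    fun t ht => h.ae_eq_heatExtension_sub_oseenDuhamel hS (Ioo_subset_Ioc_self ht)
  have hv : ∀ t ∈ Ioo 0 S, v t =ᵐ[volume] fun x =>
      UnboundedOperators.heatExtension (v 0) t x - oseenDuhamel 1 0 v v t x := by
    intro t ht
    refine Eventually.of_forall fun x => ?_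
    have h1 := hoseen 0 t le_rfl ht.1 (ht.2.trans hST) x
    rwa [sub_zero, heatFlow_of_pos _ ht.1] at h1
  have hae : ∀ t ∈ Ioo 0 S, u t =ᵐ[volume] v t :=
    oseenMild_bounded_unique one_pos hL0 h.aestronglyMeasurable_uncurry
      (aestronglyMeasurable_strip_of_continuousOn_Ico hcont hST.le)
      (fun τ hτ y => (hB τ (Ioo_subset_Icc_self hτ) y).trans (le_max_left _ _))
      (fun τ hτ y => (hM τ (Ioo_subset_Icc_self hτ) y).trans (le_max_right _ _)) hu hv
  -- continuous slices which agree a.e. agree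
  have hIoo : ∀ t ∈ Ioo 0 S, u t = v t := fun t ht =>
    ((h.classical.contDiff_velocity (Ioo_subset_Icc_self ht)).continuous.ae_eq_iff_eq volume
      (hcont.comp_continuous (continuous_const.prodMk continuous_id)
        fun x => ⟨⟨ht.1.le, ht.2.trans hST⟩, mem_univ x⟩)).1 (hae t ht)
  -- the endpoints by continuity of the time lines on `[0, S] = closure (0, S)`
  intro t ht
  funext x
  have hcu : ContinuousOn (fun s => u s x) (Icc 0 S) :=
    h.classical.smooth_velocity.continuousOn.comp (continuousOn_id.prodMk continuousOn_const)
      fun s hs => ⟨hs, mem_univ x⟩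
  have hcv : ContinuousOn (fun s => v s x) (Icc 0 S) :=
    hcont.comp (continuousOn_id.prodMk continuousOn_const)
      fun s hs => ⟨⟨hs.1, hs.2.trans_lt hST⟩, mem_univ x⟩
  have heqOn : EqOn (fun s => u s x) (fun s => v s x) (Ioo 0 S) := fun s hs => by
    show u s x = v s x
    rw [hIoo s hs]
  have hcl : Icc 0 S ⊆ closure (Ioo 0 S) := by rw [closure_Ioo hS.ne]
  exact heqOn.of_subset_closure hcu hcv Ioo_subset_Icc_self hcl ht

/-- **Tao-class solutions from `v 0` exist on every `[0, S]`, `S < T`** (Kato route).  With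
`T_max = katoMaximalTime 1 (v 0) > 0` (`kato_local_holds`): if `T_max < T`, the maximal Kato
solution on `[0, T_max)` (`exists_isKatoSolutionOn_katoMaximalTime`, `kato_unique_holds`) agrees
a.e., at every time `t ∈ (0, T_max)`, with the Tao-class solution on `[0, (t + T_max)/2]`
(`exists_isTaoSolutionOn_of_isKatoSolutionOn`, `IsTaoSolutionOn.ae_eq_of_kato`), which equals `v`
(`tao_velocity_eq_of_oseenMild`); by Fubini it is essentially bounded on `(0, T_max) × ℝ³` by the
bound of `v` on `[0, T_max] ⊆ [0, T − δ]`, and the `L^∞` continuation of Kato solutions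
(`IsKatoSolutionOn.continuation_of_bounded_holds`) produces a Kato solution beyond `T_max` —
impossible.  Hence `T ≤ T_max`, a Kato solution lives on `[0, (S + T)/2)`, and along it a
Tao-class solution on `[0, S]` exists.
[cite: LemarieRieusset2016, Prop. 12.3 with Thm. 7.2 and §9.9 (PDF pp. 147, 260, 393)] -/
theorem exists_isTaoSolutionOn_of_oseenMild {T S : ℝ} {v : ℝ → ℝ³ → ℝ³} (hT : 0 < T)
    (hsm : ContDiff ℝ ∞ (v 0)) (hcs : HasCompactSupport (v 0))
    (hdiv : VectorCalculus.IsDivFree (v 0)) (hwdiv : IsWeaklyDivFree (v 0))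
    (hcont : ContinuousOn (uncurry v) (Ico 0 T ×ˢ univ))
    (hoseen : ∀ s t : ℝ, 0 ≤ s → s < t → t < T → ∀ x,
      v t x = heatFlow (v s) (t - s) x - oseenDuhamel 1 s v v t x)
    (hbdd : ∀ δ : ℝ, 0 < δ → IsBoundedOn (Icc 0 (T - δ)) v) (hS : 0 < S) (hST : S < T) :
    ∃ (u : ℝ → ℝ³ → ℝ³) (p : ℝ → ℝ³ → ℝ), IsTaoSolutionOn S 1 (v 0) u p := by
  have hdec : HasRapidSpatialDecay (v 0) := HasRapidSpatialDecay.of_hasCompactSupport hsm hcs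
  have hdiv' : NSWave0.IsDivFree (v 0) := hdiv
  have hL3 : MemLp (v 0) 3 volume := hsm.continuous.memLp_of_hasCompactSupport hcs
  have hTm0 : 0 < katoMaximalTime 1 (v 0) :=
    katoMaximalTime_pos kato_local_holds one_pos hL3 hwdiv
  -- `T ≤ T_max`
  have hTle : ENNReal.ofReal T ≤ katoMaximalTime 1 (v 0) := by
    by_contra hlt
    rw [not_le] at hlt
    have htop : katoMaximalTime 1 (v 0) < ⊤ := lt_of_lt_of_le hlt le_top
    obtain ⟨uK, huK⟩ :=
      exists_isKatoSolutionOn_katoMaximalTime kato_unique_holds one_pos hTm0 htop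
    set S₀ : ℝ := (katoMaximalTime 1 (v 0)).toReal with hS₀
    have hS₀eq : ENNReal.ofReal S₀ = katoMaximalTime 1 (v 0) := ENNReal.ofReal_toReal htop.ne
    have hS₀0 : 0 < S₀ := ENNReal.toReal_pos hTm0.ne' htop.ne
    have hS₀T : S₀ < T := by
      rw [← hS₀eq, ENNReal.ofReal_lt_ofReal_iff hT] at hlt
      exact hlt
    -- `uK = v` a.e. on every slice of `(0, S₀)`
    have hslice : ∀ t ∈ Ioo 0 S₀, uK t =ᵐ[volume] v t := by
      intro t ht
      have htTt : t < (t + S₀) / 2 := by linarith [ht.2]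
      have hTtS : (t + S₀) / 2 < S₀ := by linarith [ht.2]
      have hTt0 : 0 < (t + S₀) / 2 := ht.1.trans htTt
      obtain ⟨u, p, hu⟩ :=
        exists_isTaoSolutionOn_of_isKatoSolutionOn one_pos hsm hdiv' hdec huK hTt0 hTtS
      have hK' := huK.mono hTtS.le
      have h1 : u t =ᵐ[volume] uK t := hu.ae_eq_of_kato one_pos hK'.mild hK'.continuousInLpOn
        hK'.aestronglyMeasurable t ⟨ht.1.le, htTt⟩
      rw [← tao_velocity_eq_of_oseenMild hcont hoseen hbdd hTt0 (hTtS.trans hS₀T) hu t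
        ⟨ht.1.le, htTt.le⟩]
      exact h1.symm
    -- hence `uK` is essentially bounded on `(0, S₀) × ℝ³`
    obtain ⟨M, hM⟩ := hbdd (T - S₀) (sub_pos.2 hS₀T)
    rw [sub_sub_cancel] at hM
    have hae := ae_restrict_prod_of_forall_ae_eq hslice huK.aestronglyMeasurable
      (aestronglyMeasurable_strip_of_continuousOn_Ico hcont hS₀T.le)
    have hbound : eLpNorm (uncurry uK) ⊤
        (volume.restrict (Ioo (S₀ - S₀) S₀ ×ˢ (univ : Set ℝ³))) < ⊤ := by
      rw [sub_self, eLpNorm_congr_ae hae, eLpNorm_exponent_top]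
      refine lt_of_le_of_lt (eLpNormEssSup_le_of_ae_bound (C := M) ?_) ENNReal.ofReal_lt_top
      filter_upwards [ae_restrict_mem (measurableSet_Ioo.prod MeasurableSet.univ)] with z hz
      exact hM z.1 (Ioo_subset_Icc_self hz.1) z.2
    obtain ⟨T', hT', w, hw⟩ :=
      IsKatoSolutionOn.continuation_of_bounded_holds one_pos hS₀0 hS₀0 huK hbound
    refine not_isKatoSolutionOn_of_katoMaximalTime_lt ?_ hw
    rw [← hS₀eq]
    exact (ENNReal.ofReal_lt_ofReal_iff (hS₀0.trans hT')).2 hT'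
  -- a Kato solution on `[0, (S + T)/2)` and the Tao-class solution on `[0, S]` along it
  have hlt : ENNReal.ofReal ((S + T) / 2) < katoMaximalTime 1 (v 0) :=
    lt_of_lt_of_le ((ENNReal.ofReal_lt_ofReal_iff hT).2 (by linarith)) hTle
  obtain ⟨uK, huK⟩ := exists_isKatoSolutionOn_of_ofReal_lt_katoMaximalTime hlt
  exact exists_isTaoSolutionOn_of_isKatoSolutionOn one_pos hsm hdiv' hdec huK hS (by linarith)

/-- **stub_oseenClassicalPackage** (Oseen gauge ⇒ classical and Leray–Hopf on closed sub-slabs).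
A field `v` on `[0, T) × ℝ³`, jointly continuous, with weakly divergence-free slices, bounded on
every `[0, T − δ]`, solving the Oseen integral equation `v(t) = e^{(t−s)Δ}v(s) − B¹_s(v,v)(t)`
between all pairs `0 ≤ s < t < T`, from a smooth compactly supported divergence-free datum `v 0`,
agrees on `[0, T)` with a classical solution `(w, q)` on `[0, T)` which is Leray–Hopf on every
`[0, T']`, `T' < T`.  Here `w = v` itself: the Tao-class solutions from `v 0` on the slabs
`[0, S]`, `S < T` (`exists_isTaoSolutionOn_of_oseenMild`), all have velocity `v`
(`tao_velocity_eq_of_oseenMild`), hence a common pressure (`IsTaoSolutionOn.pressure_eq`), which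
is `q`; joint smoothness, the momentum equation (one-sided time derivative within `Ico 0 T` =
within `Icc 0 S` at `t < S`) and `div v = 0` are read off slab by slab, and the Leray–Hopf
structure on `[0, T']` is that of the Tao-class solution (`IsTaoSolutionOn.isLerayHopfOn`,
`IsLerayHopfOn.congr_ae_slices`).
[cite: LemarieRieusset2016, Prop. 12.3 with Thm. 7.2 (PDF pp. 147, 393)] -/
theorem stub_oseenClassicalPackage :
    ∀ (T : ℝ) (v : ℝ → ℝ³ → ℝ³), 0 < T →
      ContDiff ℝ ∞ (v 0) → HasCompactSupport (v 0) → VectorCalculus.IsDivFree (v 0) →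
      ContinuousOn (uncurry v) (Ico 0 T ×ˢ univ) →
      (∀ t ∈ Ico 0 T, IsWeaklyDivFree (v t)) →
      (∀ s t : ℝ, 0 ≤ s → s < t → t < T → ∀ x,
        v t x = heatFlow (v s) (t - s) x - oseenDuhamel 1 s v v t x) →
      (∀ δ : ℝ, 0 < δ → IsBoundedOn (Icc 0 (T - δ)) v) →
      ∃ (w : ℝ → ℝ³ → ℝ³) (q : ℝ → ℝ³ → ℝ), (∀ t ∈ Ico 0 T, w t = v t) ∧
        IsClassicalNSSolutionOn (Ico 0 T) 1 0 w q ∧ ∀ T' ∈ Ioo 0 T, IsLerayHopfOn T' 1 0 (v 0) w := by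
  intro T v hT hsm hcs hdiv hcont hwdiv hoseen hbdd
  -- Tao-class solutions on every `[0, S]`, `S ∈ (0, T)`, all with velocity `v`
  have hex : ∀ S ∈ Ioo 0 T, ∃ (u : ℝ → ℝ³ → ℝ³) (p : ℝ → ℝ³ → ℝ),
      IsTaoSolutionOn S 1 (v 0) u p := fun S hS =>
    exists_isTaoSolutionOn_of_oseenMild hT hsm hcs hdiv (hwdiv 0 ⟨le_rfl, hT⟩) hcont hoseen hbdd
      hS.1 hS.2
  choose uS pS hsol using hex
  have hUv : ∀ S (hS : S ∈ Ioo 0 T), ∀ t ∈ Icc 0 S, uS S hS t = v t := fun S hS =>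
    tao_velocity_eq_of_oseenMild hcont hoseen hbdd hS.1 hS.2 (hsol S hS)
  -- the pressures agree on common slabs
  have hP : ∀ S₁ (hS₁ : S₁ ∈ Ioo 0 T) S₂ (hS₂ : S₂ ∈ Ioo 0 T), ∀ t ∈ Icc 0 (min S₁ S₂),
      pS S₁ hS₁ t = pS S₂ hS₂ t := fun S₁ hS₁ S₂ hS₂ =>
    (hsol S₁ hS₁).pressure_eq (hsol S₂ hS₂) (lt_min hS₁.1 hS₂.1) (min_le_left _ _)
      (min_le_right _ _) fun s hs => by
        rw [hUv S₁ hS₁ s ⟨hs.1, hs.2.trans (min_le_left _ _)⟩,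
          hUv S₂ hS₂ s ⟨hs.1, hs.2.trans (min_le_right _ _)⟩]
  -- the glued pressure
  have hτ : ∀ t ∈ Ico 0 T, (t + T) / 2 ∈ Ioo 0 T := fun t ht =>
    ⟨by linarith [ht.1], by linarith [ht.2]⟩
  obtain ⟨q, hq⟩ : ∃ q : ℝ → ℝ³ → ℝ, ∀ S (hS : S ∈ Ioo 0 T), ∀ t ∈ Icc 0 S, q t = pS S hS t := by
    classical
    refine ⟨fun t => if ht : t ∈ Ico 0 T then pS ((t + T) / 2) (hτ t ht) t else 0,
      fun S hS t ht => ?_⟩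
    have htT : t ∈ Ico 0 T := ⟨ht.1, ht.2.trans_lt hS.2⟩
    simp only [dif_pos htT]
    exact hP _ (hτ t htT) S hS t ⟨ht.1, le_min (by linarith [htT.2]) ht.2⟩
  refine ⟨v, q, fun t _ => rfl, ⟨?_, ?_, ?_, ?_⟩, fun T' hT' => ?_⟩
  · -- joint smoothness of the velocity (local in time)
    refine contDiffOn_of_locally_contDiffOn fun z hz => ?_
    have hz1 : z.1 ∈ Ico 0 T := (mem_prod.1 hz).1
    obtain ⟨S, hS, hzS⟩ : ∃ S ∈ Ioo 0 T, z.1 < S := ⟨_, hτ z.1 hz1, by linarith [hz1.2]⟩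
    refine ⟨Iio S ×ˢ univ, isOpen_Iio.prod isOpen_univ, ⟨hzS, mem_univ _⟩, ?_⟩
    rw [prod_inter_prod, univ_inter, Ico_inter_Iio, min_eq_right hS.2.le]
    refine ((hsol S hS).classical.smooth_velocity.mono Ico_subset_Icc_self).congr fun y hy => ?_
    show v y.1 y.2 = uS S hS y.1 y.2
    rw [hUv S hS y.1 (Ico_subset_Icc_self (mem_prod.1 hy).1)]
  · -- joint smoothness of the pressure (local in time)
    refine contDiffOn_of_locally_contDiffOn fun z hz => ?_
    have hz1 : z.1 ∈ Ico 0 T := (mem_prod.1 hz).1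
    obtain ⟨S, hS, hzS⟩ : ∃ S ∈ Ioo 0 T, z.1 < S := ⟨_, hτ z.1 hz1, by linarith [hz1.2]⟩
    refine ⟨Iio S ×ˢ univ, isOpen_Iio.prod isOpen_univ, ⟨hzS, mem_univ _⟩, ?_⟩
    rw [prod_inter_prod, univ_inter, Ico_inter_Iio, min_eq_right hS.2.le]
    refine ((hsol S hS).classical.smooth_pressure.mono Ico_subset_Icc_self).congr fun y hy => ?_
    show q y.1 y.2 = pS S hS y.1 y.2
    rw [hq S hS y.1 (Ico_subset_Icc_self (mem_prod.1 hy).1)]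
  · -- the momentum equation
    intro t ht x
    obtain ⟨S, hS, htS⟩ : ∃ S ∈ Ioo 0 T, t < S := ⟨_, hτ t ht, by linarith [ht.2]⟩
    have htI : t ∈ Icc 0 S := ⟨ht.1, htS.le⟩
    have hm := (hsol S hS).classical.momentum t htI x
    have hd : timeDerivWithin (Ico 0 T) v t x = timeDerivWithin (Icc 0 S) (uS S hS) t x := by
      rw [← (hsol S hS).classical.smooth_velocity.timeDerivWithin_eq_of_subset Ico_subset_Icc_self
        (uniqueDiffOn_Ico 0 S) ⟨ht.1, htS⟩ x]
      simp only [timeDerivWithin_apply]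
      rw [← derivWithin_inter (Iio_mem_nhds htS), Ico_inter_Iio, min_eq_right hS.2.le]
      exact derivWithin_congr (fun s hs => by rw [hUv S hS s (Ico_subset_Icc_self hs)])
        (by rw [hUv S hS t htI])
    rw [hd, ← hUv S hS t htI, hq S hS t htI]
    exact hm
  · -- incompressibility
    intro t ht
    obtain ⟨S, hS, htS⟩ : ∃ S ∈ Ioo 0 T, t < S := ⟨_, hτ t ht, by linarith [ht.2]⟩
    rw [← hUv S hS t ⟨ht.1, htS.le⟩]
    exact (hsol S hS).classical.divFree t ⟨ht.1, htS.le⟩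
  · -- Leray–Hopf on `[0, T']`
    exact ((hsol T' hT').isLerayHopfOn hT'.1).congr_ae_slices hT'.1
      (aestronglyMeasurable_strip_of_continuousOn_Ico hcont hT'.2.le)
      fun t ht => Eventually.of_forall fun x => by rw [hUv T' hT' t ht]

end Summit.NavierStokesRegularity.NavierStokesRegularity.Theorems

end
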